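import Literature.MathematicalPhysics.QuantumManyBody.DirichletBoxGap
import Literature.Probability.RandomMatrix.TwoQubitSeparabilityVolumesQubitFibreProofs
import HarnessLib

/-!
# The free Dirichlet gap for `N` particles in the box `Λ_L^N`

Topic `Literature/MathematicalPhysics/QuantumManyBody`, grouping namespace `BoseGas` (the objects
`Config N = (ℝ³)^N`, `boxN`, `TrialState`, `kineticDensity`, `energy` of
`BoseEinsteinCondensation.lean`). The FREE Bose gas (`v = 0`) in the Dirichlet box `Λ_L = (0,L)³`
has ground state `Ψ₀ = ∏ᵢ∏ₖ (2/L)^{1/2} sin(πX_{ik}/L)` with energy `E₀ = 3Nπ²/L²` and a spectral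
gap `3π²/L²` (one particle promoted from `(1,1,1)` to `(2,1,1)`: `(4+1+1)π²/L² − 3π²/L²`)
[LSSY2005, Ch. 2, (2.3) and the remark after (2.50)]. In quadratic-form language, for every
Dirichlet trial state `Ψ` (`C¹` on `(ℝ³)^N`, vanishing off `Λ_L^N`, `‖Ψ‖ = 1`):

* `freeDirichletGap` — `3Nπ²/L² + (3π²/L²) ‖Ψ − ⟨Ψ₀,Ψ⟩Ψ₀‖² ≤ energy 0 Ψ` (`N ≥ 1`, `L > 0`):
  a `δ`-near-minimiser of the free Dirichlet energy is `L²`-within `(δL²/3π²)^{1/2}` of the ray of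
  `Ψ₀` — the input of every "free-gas case" of a condensation statement;
* `lintegral_enorm_sq_freeGroundState` — `‖Ψ₀‖ = 1`.

Method: flatten `(ℝ³)^N ≅ ℝ^{N×3}` by a measure-preserving linear equivalence
(`volume_preserving_configFlatten`: Mathlib's `MeasurableEquiv.toLp` in each particle and
uncurrying — the latter's measure preservation is the tree's
`Literature.Probability.RandomMatrix.ZhangJiangXie2025.volume_preserving_curry_symm`, reused; its
inverse as a continuous linear map sends the coordinate vector `e_{(i,k)}` to the
direction `Pi.single i (EuclideanSpace.single k 1)` of `kineticDensity`), apply the cube gap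
`DirichletBox.gap_mul_lintegral_enorm_sq_le_pi`, bound the kinetic term on the closed box by
`energy 0 Ψ`, identify the ground coefficient with `⟨Ψ₀, Ψ⟩`, and use Pythagoras
(`DirichletBox.lintegral_enorm_sq_sub_inner_mul`). No definitions.

## References

* [LSSY2005] E. H. Lieb, R. Seiringer, J. P. Solovej, J. Yngvason, *The Mathematics of the Bose Gas
  and its Condensation*, Birkhäuser 2005: Ch. 2, (2.3) and after (2.50).
-/

noncomputable section

open Real intervalIntegral MeasureTheory Set Filter Topology Complex
open scoped ENNReal NNReal

namespace Literature.MathematicalPhysics.QuantumManyBody.BoseGas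


open Literature.MathematicalPhysics.QuantumManyBody.NeumannBox
open Literature.MathematicalPhysics.QuantumManyBody.DirichletBox
open scoped ComplexConjugate

/-- **Flattening configuration space preserves Lebesgue measure**: the coordinate map
`(ℝ³)^N → ℝ^{N×3}`, `X ↦ ((i,k) ↦ X_{i,k})` (Mathlib's `MeasurableEquiv.toLp` inverse in each
particle followed by uncurrying) is a measure-preserving measurable equivalence. [folklore] -/
theorem volume_preserving_configFlatten (N : ℕ) :
    MeasurePreserving ((MeasurableEquiv.piCongrRight fun _ : Fin N =>
        (MeasurableEquiv.toLp 2 (Fin 3 → ℝ)).symm).trans (MeasurableEquiv.curry (Fin N) (Fin 3) ℝ).symm)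
      (volume : Measure (Config N)) (volume : Measure (Fin N × Fin 3 → ℝ)) :=
  (MeasureTheory.volume_preserving_pi fun _ : Fin N =>
      EuclideanSpace.volume_preserving_symm_measurableEquiv_toLp (Fin 3)).trans
    (Literature.Probability.RandomMatrix.ZhangJiangXie2025.volume_preserving_curry_symm (Fin N) (Fin 3))

/-- The flattening map in coordinates: `X ↦ ((i,k) ↦ X i k)`. [folklore] -/
theorem configFlatten_apply (N : ℕ) (X : Config N) (p : Fin N × Fin 3) :
    ((MeasurableEquiv.piCongrRight fun _ : Fin N =>
        (MeasurableEquiv.toLp 2 (Fin 3 → ℝ)).symm).trans (MeasurableEquiv.curry (Fin N) (Fin 3) ℝ).symm)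
      X p = X p.1 p.2 := rfl

/-- `∫₀^L (2/L) sin²(πt/L) dt = 1`: the sine mode `(2/L)^{1/2} sin(π·/L)` is normalised.
[folklore] -/
theorem integral_two_div_mul_sin_sq {L : ℝ} (hL : 0 < L) :
    ∫ t in (0 : ℝ)..L, 2 / L * Real.sin (π * t / L) ^ 2 = 1 := by
  have hc : π / L ≠ 0 := by positivity
  have h1 : (fun t : ℝ => 2 / L * Real.sin (π * t / L) ^ 2) =
      fun t => 2 / L * (fun u => Real.sin u ^ 2) (π / L * t) := by
    funext t; congr 2; ring
  rw [h1, intervalIntegral.integral_const_mul,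
    intervalIntegral.integral_comp_mul_left (fun u => Real.sin u ^ 2) hc, integral_sin_sq]
  have hπ : π / L * L = π := by field_simp
  simp only [mul_zero, Real.sin_zero, Real.cos_zero, zero_mul, hπ, Real.sin_pi, Real.cos_pi,
    sub_zero, smul_eq_mul]
  field_simp
  ring

/-- The inverse flattening `ℝ^{N×3} → (ℝ³)^N`, `y ↦ (i ↦ (k ↦ y_{(i,k)}))`, as a continuous linear
map (a coordinate of its value). [folklore] -/
theorem configUnflattenCLM_apply (N : ℕ) (y : Fin N × Fin 3 → ℝ) (i : Fin N) (k : Fin 3) :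
    (ContinuousLinearMap.pi fun i : Fin N =>
        ((EuclideanSpace.equiv (Fin 3) ℝ).symm : (Fin 3 → ℝ) →L[ℝ] EuclideanSpace ℝ (Fin 3)).comp
          (ContinuousLinearMap.pi fun k : Fin 3 =>
            ContinuousLinearMap.proj (R := ℝ) (φ := fun _ : Fin N × Fin 3 => ℝ) (i, k))) y i k =
      y (i, k) := by
  simp [EuclideanSpace.equiv]

/-- The inverse flattening sends the coordinate vector `e_{(i,k)}` of `ℝ^{N×3}` to the direction
`Pi.single i (EuclideanSpace.single k 1)` along which `kineticDensity` differentiates. [folklore] -/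
theorem configUnflattenCLM_single (N : ℕ) (p : Fin N × Fin 3) :
    (ContinuousLinearMap.pi fun i : Fin N =>
        ((EuclideanSpace.equiv (Fin 3) ℝ).symm : (Fin 3 → ℝ) →L[ℝ] EuclideanSpace ℝ (Fin 3)).comp
          (ContinuousLinearMap.pi fun k : Fin 3 =>
            ContinuousLinearMap.proj (R := ℝ) (φ := fun _ : Fin N × Fin 3 => ℝ) (i, k)))
        (Pi.single p (1 : ℝ)) =
      (Pi.single p.1 (EuclideanSpace.single p.2 (1 : ℝ)) : Config N) := by
  ext i k
  rw [configUnflattenCLM_apply]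
  by_cases hi : i = p.1
  · subst hi
    rw [Pi.single_eq_same, PiLp.single_apply]
    by_cases hk : k = p.2
    · subst hk; simp
    · rw [if_neg hk, Pi.single_eq_of_ne]
      exact fun h => hk (congrArg Prod.snd h)
  · rw [Pi.single_eq_of_ne hi, Pi.single_eq_of_ne]
    · rfl
    · exact fun h => hi (congrArg Prod.fst h)

/-- **The free Dirichlet ground state is normalised**: with `χ(t) = (2/L)^{1/2} sin(πt/L)`,
`∫_{(ℝ³)^N} |1_{Λ^N}(X) ∏ᵢ∏ₖ χ(X_{ik})|² dX = ∏_{(i,k)} ∫₀^L (2/L) sin²(πt/L) dt = 1` (`L > 0`).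
[cite: LSSY2005, Ch. 2 (2.3)] -/
theorem lintegral_enorm_sq_freeGroundState {N : ℕ} {L : ℝ} (hL : 0 < L) :
    ∫⁻ X : Config N, ‖(boxN N L).indicator (fun X : Config N =>
        ∏ i : Fin N, ∏ k : Fin 3, ((Real.sqrt (2 / L) * Real.sin (Real.pi * X i k / L) : ℝ) : ℂ)) X‖ₑ ^ 2 = 1 := by
  set e := ((MeasurableEquiv.piCongrRight fun _ : Fin N =>
      (MeasurableEquiv.toLp 2 (Fin 3 → ℝ)).symm).trans (MeasurableEquiv.curry (Fin N) (Fin 3) ℝ).symm)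
    with he
  have hmp : MeasurePreserving e volume volume := volume_preserving_configFlatten N
  -- the one-dimensional factor
  set h : ℝ → ℝ := fun t => (Ioo (0 : ℝ) L).indicator (fun t => 2 / L * Real.sin (π * t / L) ^ 2) t
    with hh
  have hh_nn : ∀ t, 0 ≤ h t := fun t => by
    simp only [hh]
    exact Set.indicator_nonneg (fun t _ => by positivity) t
  have hh_int : Integrable h := by
    have hc : Continuous fun t : ℝ => 2 / L * Real.sin (π * t / L) ^ 2 := by fun_prop
    exact (hc.integrableOn_Icc.mono_set Ioo_subset_Icc_self).integrable_indicator measurableSet_Ioo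
  have hh_one : ∫ t, h t = 1 := by
    rw [hh, MeasureTheory.integral_indicator measurableSet_Ioo, ← integral_Ioc_eq_integral_Ioo,
      ← intervalIntegral.integral_of_le hL.le, integral_two_div_mul_sin_sq hL]
  -- the integrand is the product of the one-dimensional factors, in coordinates
  have hpt : ∀ X : Config N, ‖(boxN N L).indicator (fun X : Config N =>
      ∏ i : Fin N, ∏ k : Fin 3, ((Real.sqrt (2 / L) * Real.sin (Real.pi * X i k / L) : ℝ) : ℂ)) X‖ₑ ^ 2 =
        ENNReal.ofReal (∏ p : Fin N × Fin 3, h (e X p)) := by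
    intro X
    rw [← ofReal_norm, ← ENNReal.ofReal_pow (norm_nonneg _)]
    congr 1
    by_cases hX : X ∈ boxN N L
    · rw [Set.indicator_of_mem hX]
      have hfac : ∀ p : Fin N × Fin 3, h (e X p) = 2 / L * Real.sin (π * X p.1 p.2 / L) ^ 2 := by
        intro p
        have hp : X p.1 p.2 ∈ Ioo (0 : ℝ) L := hX p.1 p.2
        simp only [hh, he, configFlatten_apply, Set.indicator_of_mem hp]
      simp_rw [hfac]
      rw [Fintype.prod_prod_type, norm_prod, ← Finset.prod_pow]
      refine Finset.prod_congr rfl fun i _ => ?_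
      rw [norm_prod, ← Finset.prod_pow]
      refine Finset.prod_congr rfl fun k _ => ?_
      rw [Complex.norm_real, Real.norm_eq_abs, sq_abs, mul_pow, Real.sq_sqrt (by positivity)]
    · rw [Set.indicator_of_notMem hX, norm_zero, zero_pow two_ne_zero]
      obtain ⟨i, k, hik⟩ : ∃ i k, X i k ∉ Ioo (0 : ℝ) L := by
        by_contra hall
        push Not at hall
        exact hX fun i k => hall i k
      symm
      exact Finset.prod_eq_zero (Finset.mem_univ (i, k)) (by
        simp only [hh, he, configFlatten_apply, Set.indicator_of_notMem hik])
  simp_rw [hpt]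
  have hcomp : ∫⁻ X : Config N, ENNReal.ofReal (∏ p : Fin N × Fin 3, h (e X p)) =
      ∫⁻ y : Fin N × Fin 3 → ℝ, ENNReal.ofReal (∏ p : Fin N × Fin 3, h (y p)) :=
    hmp.lintegral_comp_emb e.measurableEmbedding
      (fun y : Fin N × Fin 3 → ℝ => ENNReal.ofReal (∏ p : Fin N × Fin 3, h (y p)))
  have hint : Integrable (fun y : Fin N × Fin 3 → ℝ => ∏ p : Fin N × Fin 3, h (y p)) := by
    have := Integrable.fintype_prod (f := fun _ : Fin N × Fin 3 => h) (μ := fun _ => volume)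
      (fun _ => hh_int)
    simpa only [volume_pi] using this
  rw [hcomp, ← ofReal_integral_eq_lintegral_ofReal hint
      (ae_of_all _ fun y => Finset.prod_nonneg fun p _ => hh_nn (y p)),
    integral_fintype_prod_volume_eq_pow h, hh_one, one_pow, ENNReal.ofReal_one]

/-- **The free Dirichlet gap for `N` particles in the box `Λ_L = (0,L)³`.** For `N ≥ 1`, `L > 0`
and every Dirichlet trial state `Ψ` (a `C¹` function on `(ℝ³)^N` vanishing off `Λ_L^N`,
normalised), with the free ground state `Ψ₀ = 1_{Λ^N} ∏ᵢ∏ₖ (2/L)^{1/2} sin(πX_{ik}/L)` and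
`α = ⟨Ψ₀, Ψ⟩`:
`3Nπ²/L² + (3π²/L²) ‖Ψ − αΨ₀‖² ≤ ∫ |∇Ψ|² ≤ energy 0 Ψ` — the ground-state energy `3Nπ²/L²` of the
free Dirichlet Laplacian on `Λ_L^N` and its spectral gap `3π²/L²` ("the kinetic energy of a single
particle in the first excited state", one quantum `4π²/L² − π²/L²` above the ground level), in
quadratic-form language: flatten `(ℝ³)^N ≅ ℝ^{3N}`, expand in the product sine basis of the cube,
and use `|k|² ≥ 3N + 3` for `k ≠ 𝟙`. [cite: LSSY2005, Ch. 2, (2.3) and after (2.50)] -/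
theorem freeDirichletGap {N : ℕ} {L : ℝ} (hN : 1 ≤ N) (hL : 0 < L) (Ψ : TrialState N L) :
    ENNReal.ofReal (3 * N * Real.pi ^ 2 / L ^ 2) +
        ENNReal.ofReal (3 * Real.pi ^ 2 / L ^ 2) * ∫⁻ X, (‖Ψ.ψ X -
          (∫ Y, conj ((boxN N L).indicator (fun X : Config N => ∏ i : Fin N, ∏ k : Fin 3,
              ((Real.sqrt (2 / L) * Real.sin (Real.pi * X i k / L) : ℝ) : ℂ)) Y) * Ψ.ψ Y) *
          (boxN N L).indicator (fun X : Config N => ∏ i : Fin N, ∏ k : Fin 3,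
              ((Real.sqrt (2 / L) * Real.sin (Real.pi * X i k / L) : ℝ) : ℂ)) X‖₊ : ℝ≥0∞) ^ 2 ≤
      energy 0 Ψ := by
  set Ψ₀ : Config N → ℂ := fun X => (boxN N L).indicator (fun X : Config N => ∏ i : Fin N, ∏ k : Fin 3,
      ((Real.sqrt (2 / L) * Real.sin (Real.pi * X i k / L) : ℝ) : ℂ)) X with hΨ₀
  set α : ℂ := ∫ Y, conj (Ψ₀ Y) * Ψ.ψ Y with hα
  show ENNReal.ofReal (3 * N * Real.pi ^ 2 / L ^ 2) +
      ENNReal.ofReal (3 * Real.pi ^ 2 / L ^ 2) * ∫⁻ X, (‖Ψ.ψ X - α * Ψ₀ X‖₊ : ℝ≥0∞) ^ 2 ≤ energy 0 Ψ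
  -- flattening `(ℝ³)^N ≅ ℝ^{N×3}`
  set e := ((MeasurableEquiv.piCongrRight fun _ : Fin N =>
      (MeasurableEquiv.toLp 2 (Fin 3 → ℝ)).symm).trans (MeasurableEquiv.curry (Fin N) (Fin 3) ℝ).symm)
    with he
  have hmp : MeasurePreserving e volume volume := volume_preserving_configFlatten N
  have heapp : ∀ (X : Config N) (p : Fin N × Fin 3), e X p = X p.1 p.2 := fun X p => rfl
  set Φ : (Fin N × Fin 3 → ℝ) →L[ℝ] Config N := ContinuousLinearMap.pi fun i : Fin N =>
      ((EuclideanSpace.equiv (Fin 3) ℝ).symm : (Fin 3 → ℝ) →L[ℝ] EuclideanSpace ℝ (Fin 3)).comp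
        (ContinuousLinearMap.pi fun k : Fin 3 =>
          ContinuousLinearMap.proj (R := ℝ) (φ := fun _ : Fin N × Fin 3 => ℝ) (i, k)) with hΦ
  have hΦapp : ∀ (y : Fin N × Fin 3 → ℝ) (i : Fin N) (k : Fin 3), Φ y i k = y (i, k) :=
    configUnflattenCLM_apply N
  have hΦe : ∀ X : Config N, Φ (e X) = X := by
    intro X; funext i; apply PiLp.ext; intro k
    rw [hΦapp, heapp]
  -- the pulled-back wave function on `ℝ^{N×3}`
  set g : (Fin N × Fin 3 → ℝ) → ℂ := fun y => Ψ.ψ (Φ y) with hg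
  have hgC : ContDiff ℝ 1 g := Ψ.contDiff.comp Φ.contDiff
  have hgbd : ∀ (y : Fin N × Fin 3 → ℝ) (p : Fin N × Fin 3), y p = 0 ∨ y p = L → g y = 0 := by
    intro y p hy
    refine Ψ.eq_zero _ fun hmem => ?_
    have h1 : Φ y p.1 p.2 ∈ Set.Ioo (0 : ℝ) L := hmem p.1 p.2
    rw [hΦapp] at h1
    rcases hy with h | h
    · rw [h] at h1; exact lt_irrefl _ h1.1
    · rw [h] at h1; exact lt_irrefl _ h1.2
  haveI : Nonempty (Fin N × Fin 3) := ⟨(⟨0, hN⟩, 0)⟩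
  have key := gap_mul_lintegral_enorm_sq_le_pi (ι := Fin N × Fin 3) hL hgC hgbd
  -- the closed box and the support of `Ψ`
  set S : Set (Config N) := {X | ∀ (i : Fin N) (k : Fin 3), X i k ∈ Set.Icc (0 : ℝ) L} with hS
  have hpre : e ⁻¹' (Set.Icc (0 : Fin N × Fin 3 → ℝ) fun _ => L) = S := by
    ext X
    simp only [Set.mem_preimage, Set.mem_Icc, Pi.le_def, Pi.zero_apply, heapp, Prod.forall, hS,
      Set.mem_setOf_eq]
    exact ⟨fun ⟨h0, h1⟩ i k => ⟨h0 i k, h1 i k⟩, fun h => ⟨fun i k => (h i k).1, fun i k => (h i k).2⟩⟩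
  have hSm : MeasurableSet S := hpre ▸ e.measurable measurableSet_Icc
  have hzero : ∀ X : Config N, X ∉ S → Ψ.ψ X = 0 := fun X hX =>
    Ψ.eq_zero X fun hb => hX fun i k => Set.Ioo_subset_Icc_self (hb i k)
  -- (M) the mass term is `‖Ψ‖² = 1`
  have hu1 : ∫⁻ X, ‖Ψ.ψ X‖ₑ ^ 2 = 1 := by
    have := Ψ.norm_eq; simpa only [enorm_eq_nnnorm] using this
  have hM : ∫⁻ y in Set.Icc (0 : Fin N × Fin 3 → ℝ) (fun _ => L), ‖g y‖ₑ ^ 2 = 1 := by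
    have h1 := hmp.setLIntegral_comp_preimage_emb e.measurableEmbedding (fun y => ‖g y‖ₑ ^ 2)
      (Set.Icc (0 : Fin N × Fin 3 → ℝ) fun _ => L)
    rw [← h1, hpre]
    have h2 : ∀ X, ‖g (e X)‖ₑ ^ 2 = ‖Ψ.ψ X‖ₑ ^ 2 := fun X => by simp only [hg, hΦe]
    simp_rw [h2]
    rw [← hu1, ← lintegral_indicator hSm]
    refine lintegral_congr fun X => ?_
    by_cases hX : X ∈ S
    · rw [Set.indicator_of_mem hX]
    · rw [Set.indicator_of_notMem hX, hzero X hX, enorm_zero, zero_pow two_ne_zero]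
  -- (T) the kinetic term is at most `energy 0 Ψ`
  have hderiv : ∀ (X : Config N) (p : Fin N × Fin 3),
      fderiv ℝ g (e X) (Pi.single p 1) = fderiv ℝ Ψ.ψ X (Pi.single p.1 (EuclideanSpace.single p.2 1)) := by
    intro X p
    have hcomp : g = Ψ.ψ ∘ ⇑Φ := rfl
    rw [hcomp, fderiv_comp _ ((Ψ.contDiff.differentiable one_ne_zero) _) Φ.differentiableAt,
      ContinuousLinearMap.fderiv, ContinuousLinearMap.comp_apply, hΦe, hΦ, configUnflattenCLM_single]
  have hT : ∫⁻ y in Set.Icc (0 : Fin N × Fin 3 → ℝ) (fun _ => L),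
      ∑ p, ‖fderiv ℝ g y (Pi.single p 1)‖ₑ ^ 2 ≤ energy 0 Ψ := by
    have h1 := hmp.setLIntegral_comp_preimage_emb e.measurableEmbedding
      (fun y => ∑ p, ‖fderiv ℝ g y (Pi.single p 1)‖ₑ ^ 2) (Set.Icc (0 : Fin N × Fin 3 → ℝ) fun _ => L)
    rw [← h1]
    simp_rw [hderiv]
    calc ∫⁻ X in e ⁻¹' Set.Icc (0 : Fin N × Fin 3 → ℝ) (fun _ => L),
          ∑ p : Fin N × Fin 3, ‖fderiv ℝ Ψ.ψ X (Pi.single p.1 (EuclideanSpace.single p.2 1))‖ₑ ^ 2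
        ≤ ∫⁻ X, ∑ p : Fin N × Fin 3, ‖fderiv ℝ Ψ.ψ X (Pi.single p.1 (EuclideanSpace.single p.2 1))‖ₑ ^ 2 :=
          setLIntegral_le_lintegral _ _
      _ = ∫⁻ X, kineticDensity Ψ.ψ X := by
          refine lintegral_congr fun X => ?_
          rw [kineticDensity, Fintype.sum_prod_type]
          simp only [enorm_eq_nnnorm]
      _ ≤ energy 0 Ψ := lintegral_mono fun X => le_self_add
  -- (c) the ground coefficient is `α`
  have hsin : ∀ t : ℝ, Real.sin (waveNumber L 1 * t) = Real.sin (Real.pi * t / L) := fun t => by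
    simp only [waveNumber, Nat.cast_one, one_mul]; ring_nf
  have hptw : ∀ X : Config N,
      ((∏ p : Fin N × Fin 3, Real.sqrt (2 / L) * Real.sin (waveNumber L 1 * e X p) : ℝ) : ℂ) * g (e X) =
        conj (Ψ₀ X) * Ψ.ψ X := by
    intro X
    have hgX : g (e X) = Ψ.ψ X := by simp only [hg, hΦe]
    rw [hgX]
    by_cases hX : X ∈ boxN N L
    · congr 1
      simp only [hΨ₀, Set.indicator_of_mem hX, map_prod, Complex.conj_ofReal]
      rw [Complex.ofReal_prod, Fintype.prod_prod_type]
      simp only [heapp, hsin]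
    · rw [Ψ.eq_zero X hX, mul_zero, mul_zero]
  have hc : ∫ y in Set.Icc (0 : Fin N × Fin 3 → ℝ) (fun _ => L),
      ((∏ p : Fin N × Fin 3, Real.sqrt (2 / L) * Real.sin (waveNumber L 1 * y p) : ℝ) : ℂ) * g y = α := by
    have h1 := hmp.setIntegral_preimage_emb e.measurableEmbedding
      (fun y => ((∏ p : Fin N × Fin 3, Real.sqrt (2 / L) * Real.sin (waveNumber L 1 * y p) : ℝ) : ℂ) * g y)
      (Set.Icc (0 : Fin N × Fin 3 → ℝ) fun _ => L)
    rw [← h1]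
    simp_rw [hptw]
    rw [hpre, hα]
    exact setIntegral_eq_integral_of_forall_compl_eq_zero fun X hX => by rw [hzero X hX, mul_zero]
  -- Pythagoras
  have hbox : boxN N L = e ⁻¹' (Set.pi Set.univ fun _ : Fin N × Fin 3 => Set.Ioo (0 : ℝ) L) := by
    ext X
    simp only [Set.mem_preimage, Set.mem_univ_pi, heapp, Prod.forall]
    rfl
  have hboxm : MeasurableSet (boxN N L) :=
    hbox ▸ e.measurable (MeasurableSet.univ_pi fun _ => measurableSet_Ioo)
  have hv_meas : AEStronglyMeasurable Ψ₀ volume := by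
    refine (Continuous.aestronglyMeasurable ?_).indicator hboxm
    fun_prop
  have hP := lintegral_enorm_sq_sub_inner_mul (μ := volume) Ψ.contDiff.continuous.aestronglyMeasurable
    hv_meas hu1 (lintegral_enorm_sq_freeGroundState (N := N) hL)
  rw [← hα] at hP
  -- assemble
  have hcard : ((Fintype.card (Fin N × Fin 3) : ℕ) : ℝ) = 3 * N := by
    rw [Fintype.card_prod, Fintype.card_fin, Fintype.card_fin]; push_cast; ring
  rw [hM, mul_one, hc, hcard] at key
  have hαe : ‖α‖ₑ ^ 2 = ENNReal.ofReal (‖α‖ ^ 2) := by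
    rw [← ofReal_norm, ENNReal.ofReal_pow (norm_nonneg _)]
  rw [hαe, ← ENNReal.ofReal_mul (by positivity)] at key
  have key' : ENNReal.ofReal ((3 * N + 3) * (π / L) ^ 2) ≤
      energy 0 Ψ + ENNReal.ofReal (3 * (π / L) ^ 2 * ‖α‖ ^ 2) := key.trans (add_le_add hT le_rfl)
  have hgoal : ENNReal.ofReal (3 * N * Real.pi ^ 2 / L ^ 2) +
      ENNReal.ofReal (3 * Real.pi ^ 2 / L ^ 2) * ∫⁻ X, (‖Ψ.ψ X - α * Ψ₀ X‖₊ : ℝ≥0∞) ^ 2 =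
        ENNReal.ofReal ((3 * N + 3) * (π / L) ^ 2 - 3 * (π / L) ^ 2 * ‖α‖ ^ 2) := by
    have h1 : ∫⁻ X, (‖Ψ.ψ X - α * Ψ₀ X‖₊ : ℝ≥0∞) ^ 2 = ENNReal.ofReal (1 - ‖α‖ ^ 2) := by
      have := hP.1; simpa only [enorm_eq_nnnorm] using this
    rw [h1, ← ENNReal.ofReal_mul (by positivity), ← ENNReal.ofReal_add (by positivity)
      (mul_nonneg (by positivity) (by linarith [hP.2]))]
    congr 1
    field_simp
    ring
  rw [hgoal, ENNReal.ofReal_sub _ (by positivity)]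
  exact tsub_le_iff_right.mpr key'

end Literature.MathematicalPhysics.QuantumManyBody.BoseGas

end
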